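import Mathlib
import HarnessLib
import Summits.CriticalPhenomena.Ising3DConformalLimit.Theses.PrecisionLaplacian
import Summits.CriticalPhenomena.Ising3DConformalLimit.Theorems.PrecisionLaplacianPrecisionIsLaplacianInvMonotone
import Summits.CriticalPhenomena.Ising3DConformalLimit.Theorems.PrecisionLaplacianPrecisionIsLaplacianConvolution
import Literature.LinearAlgebra.Matrix.InverseMMatrixProofs
import Literature.Probability.LatticeModels.HighDimPointwiseTriviality
import Literature.Probability.LatticeModels.CriticalTwoPointLawDimension
import Literature.Probability.LatticeModels.SusceptibilityMeanFieldBound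
import Literature.Probability.LatticeModels.CriticalTwoPointBounds

/-!
# The precision operator is a Laplacian (route `PrecisionLaplacian`, item `PrecisionIsLaplacian`)

Closes item stmt-CriticalPhenomena-4803 of `CriticalPhenomena/Ising3DConformalLimit`:
`theorem PrecisionIsLaplacian_proof :
  Summit.CriticalPhenomena.Ising3DConformalLimit.Theses.PrecisionLaplacian.PrecisionIsLaplacian`.

**Statement.** Let `G = criticalTwoPoint 3` and `G_A = (G(q − p))_{p,q ∈ A}` for finite `A ⊂ ℤ³`.
If every `G_A` is positive definite with `(G_A)⁻¹` a Z-matrix with nonnegative row sums (the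
symmetric-potential hypothesis, conclusion of `InverseMCriticalKernel`), then
`m(y) := inf_{A ∋ 0,y} −(G_A)⁻¹(0,y)` is summable, `Σ_y m(y) = 0`, `m ≥ 0` off the origin,
`m(0) < 0`, and `Σ_y m(y) G(z − y) = −δ_{z0}`.

**Proof (elementary; no Fourier analysis).**
* Matrix side (this file): with `G ≥ 0` each `G_A` is an inverse M-matrix
  (`Literature.LinearAlgebra.Matrix.IsInverseMMatrix`), so the iterated bordering formula
  (DMS 2014, Lemma 2.32, eq. (2.6); `inv_submatrix_apply_le_inv_apply`) gives the Schur
  monotonicity `(G_A)⁻¹ ≤ (G_{A'})⁻¹|_A` entrywise for `A ⊆ A'`; row `0` of `(G_A)⁻¹ G_A = 1` is the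
  finite-volume convolution identity; row `0` of `G_A (G_A)⁻¹ = 1` with the Z-signs, the symmetry
  of `(G_A)⁻¹` and the row-sum bound gives the finite-energy bound
  `(G_A)⁻¹(0,0) ≤ 1/(G(0) − s)` where `s := sup_{w ≠ 0} G(w) < G(0)` (`G(w) < G(0)` for `w ≠ 0` by
  positive definiteness of the `2 × 2` Gram matrix, and `G → 0`, `criticalTwoPoint_tendsto_zero_cofinite`).
* `ℓ¹` side (`…Rows.lean`, `…Convolution.lean`, `pil_abstract`): summability from the uniform mass
  bound, the no-defect passage to the limit by an `ε` / finite-set split, and conservativity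
  `κ = 0` from `χ(β_c) = ∞` (`susceptibility_eq_top_of_criticalBeta_le`,
  `twoPointPlus_criticalBeta_eq_twoPointFree_holds`) by the sup-over-translates argument.
Inputs on `G`: `criticalTwoPoint_nonneg'`, `criticalTwoPoint_le_one'`, `criticalTwoPoint_zero'`,
`criticalTwoPoint_neg`, `criticalTwoPoint_tendsto_zero_cofinite`.
-/

namespace Summit.CriticalPhenomena.Ising3DConformalLimit.Theorems

open scoped Matrix
open Filter Topology Finset Function
open Literature.Probability.LatticeModels (Site)

section MatrixSide

open Literature.LinearAlgebra.Matrix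

variable {G : Site 3 → ℝ} {r : Finset (Site 3) → Site 3 → ℝ}

/-- Under the symmetric-potential hypothesis and `G ≥ 0`, every Gram matrix `G_A` is an inverse
M-matrix in the sense of `Literature.LinearAlgebra.Matrix.IsInverseMMatrix`. -/
theorem pil_isInverseMMatrix (hG0 : ∀ x, 0 ≤ G x)
    (HP : ∀ A : Finset (Site 3), (Matrix.of fun p q : ↥A => G (q.1 - p.1)).PosDef ∧
      ∀ u v : ↥A, (u ≠ v → (Matrix.of fun p q : ↥A => G (q.1 - p.1))⁻¹ u v ≤ 0) ∧
        0 ≤ ∑ w, (Matrix.of fun p q : ↥A => G (q.1 - p.1))⁻¹ u w)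
    (A : Finset (Site 3)) : IsInverseMMatrix (Matrix.of fun p q : ↥A => G (q.1 - p.1)) :=
  ⟨fun _ _ => hG0 _, (Matrix.isUnit_iff_isUnit_det _).mp (HP A).1.isUnit,
    fun u v huv => ((HP A).2 u v).1 huv⟩

/-- **Schur monotonicity.** For `A ⊆ A'` the inverse Gram matrices satisfy
`(G_A)⁻¹ p q ≤ (G_{A'})⁻¹ p q` entrywise (iterated bordering, `inv_submatrix_apply_le_inv_apply`). -/
theorem pil_inv_mono (hG0 : ∀ x, 0 ≤ G x)
    (HP : ∀ A : Finset (Site 3), (Matrix.of fun p q : ↥A => G (q.1 - p.1)).PosDef ∧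
      ∀ u v : ↥A, (u ≠ v → (Matrix.of fun p q : ↥A => G (q.1 - p.1))⁻¹ u v ≤ 0) ∧
        0 ≤ ∑ w, (Matrix.of fun p q : ↥A => G (q.1 - p.1))⁻¹ u w)
    {A A' : Finset (Site 3)} (hAA' : A ⊆ A') (p q : ↥A) :
    (Matrix.of fun p q : ↥A => G (q.1 - p.1))⁻¹ p q ≤
      (Matrix.of fun p q : ↥A' => G (q.1 - p.1))⁻¹ ⟨p.1, hAA' p.2⟩ ⟨q.1, hAA' q.2⟩ := by
  let f : ↥A ↪ ↥A' := ⟨fun p => ⟨p.1, hAA' p.2⟩, fun a b h => by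
    have h' := congrArg Subtype.val h
    exact Subtype.ext h'⟩
  have hsub : (Matrix.of fun p q : ↥A' => G (q.1 - p.1)).submatrix f f
      = Matrix.of fun p q : ↥A => G (q.1 - p.1) := rfl
  have h := inv_submatrix_apply_le_inv_apply (↥A') (↥A) (Matrix.of fun p q : ↥A' => G (q.1 - p.1)) f
    (pil_isInverseMMatrix hG0 HP A') p q
  rwa [hsub] at h

/-- The row function `r A` agrees with the origin row of `(G_A)⁻¹` on `A`. -/
theorem pil_r_apply
    (hr : ∀ A y, r A y = if h : (0 : Site 3) ∈ A ∧ y ∈ A then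
      (Matrix.of fun p q : ↥A => G (q.1 - p.1))⁻¹ ⟨0, h.1⟩ ⟨y, h.2⟩ else 0)
    {A : Finset (Site 3)} (h0 : (0 : Site 3) ∈ A) (w : ↥A) :
    r A w.1 = (Matrix.of fun p q : ↥A => G (q.1 - p.1))⁻¹ ⟨0, h0⟩ w := by
  rw [hr, dif_pos ⟨h0, w.2⟩]

/-- Z-signs of the rows: `r A y ≤ 0` for `y ≠ 0`. -/
theorem pil_rZ
    (HP : ∀ A : Finset (Site 3), (Matrix.of fun p q : ↥A => G (q.1 - p.1)).PosDef ∧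
      ∀ u v : ↥A, (u ≠ v → (Matrix.of fun p q : ↥A => G (q.1 - p.1))⁻¹ u v ≤ 0) ∧
        0 ≤ ∑ w, (Matrix.of fun p q : ↥A => G (q.1 - p.1))⁻¹ u w)
    (hr : ∀ A y, r A y = if h : (0 : Site 3) ∈ A ∧ y ∈ A then
      (Matrix.of fun p q : ↥A => G (q.1 - p.1))⁻¹ ⟨0, h.1⟩ ⟨y, h.2⟩ else 0)
    (A : Finset (Site 3)) (y : Site 3) (hy : y ≠ 0) : r A y ≤ 0 := by
  rw [hr]
  split_ifs with h
  · exact ((HP A).2 ⟨0, h.1⟩ ⟨y, h.2⟩).1 (fun e => hy (congrArg Subtype.val e).symm)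
  · exact le_rfl

/-- Nonnegative row sums: `0 ≤ Σ_{y ∈ A} r A y` for `0 ∈ A`. -/
theorem pil_rsum
    (HP : ∀ A : Finset (Site 3), (Matrix.of fun p q : ↥A => G (q.1 - p.1)).PosDef ∧
      ∀ u v : ↥A, (u ≠ v → (Matrix.of fun p q : ↥A => G (q.1 - p.1))⁻¹ u v ≤ 0) ∧
        0 ≤ ∑ w, (Matrix.of fun p q : ↥A => G (q.1 - p.1))⁻¹ u w)
    (hr : ∀ A y, r A y = if h : (0 : Site 3) ∈ A ∧ y ∈ A then
      (Matrix.of fun p q : ↥A => G (q.1 - p.1))⁻¹ ⟨0, h.1⟩ ⟨y, h.2⟩ else 0)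
    (A : Finset (Site 3)) (h0 : (0 : Site 3) ∈ A) : 0 ≤ ∑ y ∈ A, r A y := by
  rw [← Finset.sum_coe_sort A]
  have h := ((HP A).2 ⟨0, h0⟩ ⟨0, h0⟩).2
  refine h.trans_eq (Finset.sum_congr rfl fun w _ => ?_)
  rw [pil_r_apply hr h0 w]

/-- The row identity `Σ_{y ∈ A} r A y · G(z − y) = δ_{0z}` for `0, z ∈ A`
(row `0` of `(G_A)⁻¹ G_A = 1`). -/
theorem pil_rid
    (HP : ∀ A : Finset (Site 3), (Matrix.of fun p q : ↥A => G (q.1 - p.1)).PosDef ∧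
      ∀ u v : ↥A, (u ≠ v → (Matrix.of fun p q : ↥A => G (q.1 - p.1))⁻¹ u v ≤ 0) ∧
        0 ≤ ∑ w, (Matrix.of fun p q : ↥A => G (q.1 - p.1))⁻¹ u w)
    (hr : ∀ A y, r A y = if h : (0 : Site 3) ∈ A ∧ y ∈ A then
      (Matrix.of fun p q : ↥A => G (q.1 - p.1))⁻¹ ⟨0, h.1⟩ ⟨y, h.2⟩ else 0)
    (A : Finset (Site 3)) (h0 : (0 : Site 3) ∈ A) (z : Site 3) (hz : z ∈ A) :
    ∑ y ∈ A, r A y * G (z - y) = if z = 0 then 1 else 0 := by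
  have hdet : IsUnit (Matrix.of fun p q : ↥A => G (q.1 - p.1)).det :=
    (Matrix.isUnit_iff_isUnit_det _).mp (HP A).1.isUnit
  have h := congrFun (congrFun (Matrix.nonsing_inv_mul _ hdet) ⟨0, h0⟩) ⟨z, hz⟩
  rw [Matrix.mul_apply, Matrix.one_apply] at h
  rw [← Finset.sum_coe_sort A]
  have h' : ∑ w : ↥A, r A w.1 * G (z - w.1)
      = ∑ w : ↥A, (Matrix.of fun p q : ↥A => G (q.1 - p.1))⁻¹ ⟨0, h0⟩ w *
          (Matrix.of fun p q : ↥A => G (q.1 - p.1)) w ⟨z, hz⟩ :=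
    Finset.sum_congr rfl fun w _ => by rw [pil_r_apply hr h0 w, Matrix.of_apply]
  rw [h', h]
  by_cases hz0 : z = 0
  · subst hz0; simp
  · rw [if_neg hz0, if_neg (fun e => hz0 (congrArg Subtype.val e).symm)]

/-- Schur monotonicity of the rows: `r A y ≤ r A' y` for `0, y ∈ A ⊆ A'`. -/
theorem pil_rmono (hG0 : ∀ x, 0 ≤ G x)
    (HP : ∀ A : Finset (Site 3), (Matrix.of fun p q : ↥A => G (q.1 - p.1)).PosDef ∧
      ∀ u v : ↥A, (u ≠ v → (Matrix.of fun p q : ↥A => G (q.1 - p.1))⁻¹ u v ≤ 0) ∧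
        0 ≤ ∑ w, (Matrix.of fun p q : ↥A => G (q.1 - p.1))⁻¹ u w)
    (hr : ∀ A y, r A y = if h : (0 : Site 3) ∈ A ∧ y ∈ A then
      (Matrix.of fun p q : ↥A => G (q.1 - p.1))⁻¹ ⟨0, h.1⟩ ⟨y, h.2⟩ else 0)
    (A A' : Finset (Site 3)) (h0 : (0 : Site 3) ∈ A) (hAA' : A ⊆ A') (y : Site 3) (hy : y ∈ A) :
    r A y ≤ r A' y := by
  rw [hr A y, hr A' y, dif_pos ⟨h0, hy⟩, dif_pos ⟨hAA' h0, hAA' hy⟩]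
  exact pil_inv_mono hG0 HP hAA' ⟨0, h0⟩ ⟨y, hy⟩

/-- **Finite energy bound** `r A 0 = (G_A)⁻¹(0,0) ≤ 1/(G 0 − s)` whenever `G ≤ s < G 0` off the
origin: row `0` of `G_A (G_A)⁻¹ = 1`, the Z-signs, symmetry of `(G_A)⁻¹` and the row-sum bound
give `1 ≥ (G 0 − s) · (G_A)⁻¹(0,0)`. -/
theorem pil_rD
    (HP : ∀ A : Finset (Site 3), (Matrix.of fun p q : ↥A => G (q.1 - p.1)).PosDef ∧
      ∀ u v : ↥A, (u ≠ v → (Matrix.of fun p q : ↥A => G (q.1 - p.1))⁻¹ u v ≤ 0) ∧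
        0 ≤ ∑ w, (Matrix.of fun p q : ↥A => G (q.1 - p.1))⁻¹ u w)
    (hr : ∀ A y, r A y = if h : (0 : Site 3) ∈ A ∧ y ∈ A then
      (Matrix.of fun p q : ↥A => G (q.1 - p.1))⁻¹ ⟨0, h.1⟩ ⟨y, h.2⟩ else 0)
    {s : ℝ} (hs0 : 0 ≤ s) (hs : ∀ w, w ≠ 0 → G w ≤ s) (hsG : s < G 0)
    (A : Finset (Site 3)) (h0 : (0 : Site 3) ∈ A) : r A 0 ≤ 1 / (G 0 - s) := by
  set M : Matrix ↥A ↥A ℝ := Matrix.of fun p q : ↥A => G (q.1 - p.1) with hM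
  set o : ↥A := ⟨0, h0⟩ with ho
  have hPD : M.PosDef := (HP A).1
  have hdet : IsUnit M.det := (Matrix.isUnit_iff_isUnit_det _).mp hPD.isUnit
  -- symmetry of `M⁻¹`
  have hMT : Mᵀ = M := by
    have h := hPD.isHermitian
    rw [Matrix.IsHermitian, Matrix.conjTranspose_eq_transpose_of_trivial] at h
    exact h
  have hsymm : ∀ u v : ↥A, M⁻¹ u v = M⁻¹ v u := by
    intro u v
    have h := congrFun (congrFun (Matrix.transpose_nonsing_inv M) v) u
    rw [hMT, Matrix.transpose_apply] at h
    exact h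
  -- row `o` of `M M⁻¹ = 1`
  have h1 : ∑ w : ↥A, M o w * M⁻¹ w o = 1 := by
    have h := congrFun (congrFun (Matrix.mul_nonsing_inv M hdet) o) o
    rwa [Matrix.mul_apply, Matrix.one_apply_eq] at h
  rw [← Finset.add_sum_erase Finset.univ _ (Finset.mem_univ o)] at h1
  have hMoo : M o o = G 0 := by simp [hM, ho]
  -- the off-origin summands are `≥ s · M⁻¹ o w`
  have h2 : ∑ w ∈ Finset.univ.erase o, s * M⁻¹ o w
      ≤ ∑ w ∈ Finset.univ.erase o, M o w * M⁻¹ w o := by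
    refine Finset.sum_le_sum fun w hw => ?_
    have hwo : w ≠ o := Finset.ne_of_mem_erase hw
    have hw0 : w.1 ≠ 0 := fun e => hwo (Subtype.ext e)
    have hZ : M⁻¹ o w ≤ 0 := ((HP A).2 o w).1 (Ne.symm hwo)
    rw [hsymm w o]
    have hMow : M o w = G w.1 := by simp [hM, ho]
    rw [hMow]
    exact mul_le_mul_of_nonpos_right (hs w.1 hw0) hZ
  have h3 : ∑ w ∈ Finset.univ.erase o, s * M⁻¹ o w = s * (∑ w, M⁻¹ o w - M⁻¹ o o) := by
    rw [← Finset.mul_sum, Finset.sum_erase_eq_sub (Finset.mem_univ o)]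
  have h4 : 0 ≤ ∑ w, M⁻¹ o w := ((HP A).2 o o).2
  have h6 : 0 ≤ s * ∑ w, M⁻¹ o w := mul_nonneg hs0 h4
  have hr0 : r A 0 = M⁻¹ o o := pil_r_apply hr h0 o
  rw [hr0, le_div_iff₀ (sub_pos.2 hsG)]
  rw [hMoo] at h1
  nlinarith [h1, h2, h3, h4, h6]

/-- Strict decay off the origin: `G w < G 0` for `w ≠ 0` (positive definiteness of the `2 × 2`
Gram matrix on `{0, w}` tested against `e₀ − e_w`). -/
theorem pil_G_lt
    (HP : ∀ A : Finset (Site 3), (Matrix.of fun p q : ↥A => G (q.1 - p.1)).PosDef ∧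
      ∀ u v : ↥A, (u ≠ v → (Matrix.of fun p q : ↥A => G (q.1 - p.1))⁻¹ u v ≤ 0) ∧
        0 ≤ ∑ w, (Matrix.of fun p q : ↥A => G (q.1 - p.1))⁻¹ u w)
    (hGsym : ∀ x, G (-x) = G x) {w : Site 3} (hw : w ≠ 0) : G w < G 0 := by
  set A : Finset (Site 3) := {0, w} with hA
  have h0 : (0 : Site 3) ∈ A := by simp [hA]
  have hwA : w ∈ A := by simp [hA]
  set M : Matrix ↥A ↥A ℝ := Matrix.of fun p q : ↥A => G (q.1 - p.1) with hM
  have hPD : M.PosDef := (HP A).1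
  set o : ↥A := ⟨0, h0⟩ with ho
  set w' : ↥A := ⟨w, hwA⟩ with hw'
  have how : o ≠ w' := fun e => hw (congrArg Subtype.val e).symm
  set x : ↥A → ℝ := Pi.single o 1 - Pi.single w' 1 with hx
  have hxo : x o = 1 := by
    simp [hx, Pi.single_eq_of_ne how]
  have hxne : x ≠ 0 := by
    intro h
    have := congrFun h o
    rw [hxo] at this
    exact one_ne_zero this
  have hpos := hPD.dotProduct_mulVec_pos hxne
  simp only [star_trivial] at hpos
  have hcalc : x ⬝ᵥ (M *ᵥ x) = 2 * G 0 - 2 * G w := by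
    simp only [hx, Matrix.mulVec_sub, dotProduct_sub, sub_dotProduct, Matrix.mulVec_single_one,
      single_one_dotProduct, Matrix.col_apply, hM, Matrix.of_apply, ho, hw', sub_zero, sub_self,
      zero_sub, hGsym]
    ring
  linarith

/-- A uniform level `s` with `0 ≤ s < G 0` and `G ≤ s` off the origin (finitely many sites have
`G ≥ G 0 / 2` since `G → 0`; on those `G < G 0` strictly). -/
theorem pil_exists_s (hGlim : Tendsto G cofinite (𝓝 0)) (hG00 : 0 < G 0)
    (hlt : ∀ w, w ≠ 0 → G w < G 0) :
    ∃ s : ℝ, 0 ≤ s ∧ s < G 0 ∧ ∀ w, w ≠ 0 → G w ≤ s := by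
  have hfin : {w : Site 3 | ¬ (G w < G 0 / 2)}.Finite :=
    Filter.eventually_cofinite.1 (hGlim.eventually (gt_mem_nhds (half_pos hG00)))
  set F := hfin.toFinset with hF
  set S : Finset ℝ := insert (G 0 / 2) ((F.erase 0).image G) with hS
  have hSne : S.Nonempty := Finset.insert_nonempty _ _
  refine ⟨S.max' hSne, ?_, ?_, ?_⟩
  · exact (half_pos hG00).le.trans (S.le_max' _ (Finset.mem_insert_self _ _))
  · refine (Finset.max'_lt_iff S hSne).2 fun y hy => ?_
    rcases Finset.mem_insert.1 hy with rfl | hy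
    · linarith
    · obtain ⟨w, hw, rfl⟩ := Finset.mem_image.1 hy
      exact hlt w (Finset.ne_of_mem_erase hw)
  · intro w hw
    by_cases hwF : w ∈ F
    · exact S.le_max' _ (Finset.mem_insert_of_mem
        (Finset.mem_image_of_mem G (Finset.mem_erase.2 ⟨hw, hwF⟩)))
    · have h : G w < G 0 / 2 := by
        by_contra h
        exact hwF (hfin.mem_toFinset.2 h)
      exact h.le.trans (S.le_max' _ (Finset.mem_insert_self _ _))

end MatrixSide

section Critical

open Literature.Probability.LatticeModels

/-- `χ(β_c) = ∞` on `ℤ³`: the critical two-point function is not summable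
(`susceptibility_eq_top_of_criticalBeta_le` with `μ⁺ = μ^f` on pairs at `β_c`, ADS 2015). -/
theorem criticalTwoPoint_three_not_summable : ¬ Summable (criticalTwoPoint 3) := by
  intro hs
  have htop := susceptibility_eq_top_of_criticalBeta_le (d := 3) (by norm_num) le_rfl
  have heq : ∀ x, twoPointFree 3 (criticalBeta 3) x = criticalTwoPoint 3 x := fun x =>
    (twoPointPlus_criticalBeta_eq_twoPointFree_holds (d := 3) le_rfl x).symm
  unfold susceptibility at htop
  simp_rw [heq] at htop
  rw [← ENNReal.ofReal_tsum_of_nonneg (fun x => criticalTwoPoint_nonneg' x) hs] at htop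
  exact ENNReal.ofReal_ne_top htop

/-- **Item `PrecisionIsLaplacian` (stmt-CriticalPhenomena-4803), proved as stated.** Under the
symmetric-potential hypothesis on the Gram matrices of `G = criticalTwoPoint 3`, the function
`m(y) = inf_{A ∋ 0,y} −(G_A)⁻¹(0,y)` is summable, sums to `0`, is `≥ 0` off the origin, `< 0` at
the origin, and `Σ_y m(y) G(z − y) = −δ_{z0}`. -/
theorem PrecisionIsLaplacian_proof :
    Summit.CriticalPhenomena.Ising3DConformalLimit.Theses.PrecisionLaplacian.PrecisionIsLaplacian := by
  unfold Summit.CriticalPhenomena.Ising3DConformalLimit.Theses.PrecisionLaplacian.PrecisionIsLaplacian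
  intro HP
  have hG0 : ∀ x, 0 ≤ criticalTwoPoint 3 x := fun x => criticalTwoPoint_nonneg' x
  have hGb : ∀ x, criticalTwoPoint 3 x ≤ criticalTwoPoint 3 0 := fun x => by
    rw [criticalTwoPoint_zero']
    exact criticalTwoPoint_le_one' x
  have hGlim : Tendsto (criticalTwoPoint 3) cofinite (𝓝 0) :=
    criticalTwoPoint_tendsto_zero_cofinite
  have hGns : ¬ Summable (criticalTwoPoint 3) := criticalTwoPoint_three_not_summable
  have hGsym : ∀ x, criticalTwoPoint 3 (-x) = criticalTwoPoint 3 x := fun x =>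
    criticalTwoPoint_neg x
  have hG00 : 0 < criticalTwoPoint 3 0 := by
    rw [criticalTwoPoint_zero']
    exact one_pos
  set r : Finset (Site 3) → Site 3 → ℝ := fun A y =>
    if h : (0 : Site 3) ∈ A ∧ y ∈ A then
      (Matrix.of fun p q : ↥A => criticalTwoPoint 3 (q.1 - p.1))⁻¹ ⟨0, h.1⟩ ⟨y, h.2⟩ else 0
    with hrdef
  have hr : ∀ A y, r A y = if h : (0 : Site 3) ∈ A ∧ y ∈ A then
      (Matrix.of fun p q : ↥A => criticalTwoPoint 3 (q.1 - p.1))⁻¹ ⟨0, h.1⟩ ⟨y, h.2⟩ else 0 :=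
    fun A y => rfl
  obtain ⟨s, hs0, hsG, hs⟩ := pil_exists_s hGlim hG00 (fun w hw => pil_G_lt HP hGsym hw)
  have hm : ∀ y, (fun y : Site 3 => ⨅ A : {A : Finset (Site 3) // (0 : Site 3) ∈ A ∧ y ∈ A},
      -((Matrix.of fun p q : ↥A.1 => criticalTwoPoint 3 (q.1 - p.1))⁻¹ ⟨0, A.2.1⟩ ⟨y, A.2.2⟩)) y
      = ⨅ A : {A : Finset (Site 3) // (0 : Site 3) ∈ A ∧ y ∈ A}, -r A.1 y := by
    intro y
    show (⨅ A : {A : Finset (Site 3) // (0 : Site 3) ∈ A ∧ y ∈ A},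
      -((Matrix.of fun p q : ↥A.1 => criticalTwoPoint 3 (q.1 - p.1))⁻¹ ⟨0, A.2.1⟩ ⟨y, A.2.2⟩))
      = ⨅ A : {A : Finset (Site 3) // (0 : Site 3) ∈ A ∧ y ∈ A}, -r A.1 y
    congr 1
    funext A
    rw [hr, dif_pos A.2]
  exact pil_abstract hG0 hGb hGlim hGns (pil_rZ HP hr) (pil_rsum HP hr) (pil_rid HP hr)
    (pil_rmono hG0 HP hr) (pil_rD HP hr hs0 hs hsG) hm

end Critical

end Summit.CriticalPhenomena.Ising3DConformalLimit.Theorems
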